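import Literature.NumberTheory.Irrationality.RhinViola1996.TheoremTwoOneBase
import Literature.NumberTheory.Irrationality.RhinViola1996.PermutationGroupZeta2Proofs
import HarnessLib

/-!
# Rhin–Viola 1996, Theorem 2.1: `I(h,i,j,k,l) = a − bζ(2)` with `b ∈ ℤ` and `d_{M₀} d_{N₀} a ∈ ℤ`

Topic `Literature/NumberTheory/Irrationality/RhinViola1996` (file 5 of 5). Source: G. Rhin, C. Viola, *On a permutation
group related to ζ(2)*, Acta Arith. **77** (1996) 23–56 [RhinViola1996] (held text `paper:doi-10-4064-aa-77-1-23-56`,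
pp. 29–32 = p0007–p0010 read on the page), §2:

  **Theorem 2.1.** Let `h, i, j, k, l` be non-negative integers, and let
  (2.4) `M₀ = max{k+l−i, l+h−j, i+j−l}`, `N₀ = max{j+k−h, min{k+l−i, l+h−j}, h+i−k}`.
  Then the integral `J₀ = ∫₀¹∫₀¹ x^h(1−x)^i y^k(1−y)^j/(1−xy)^{i+j−l} · dx dy/(1−xy)` satisfies `J₀ = a − bζ(2)` with
  `b ∈ ℤ` and `d_{M₀} d_{N₀} a ∈ ℤ`.

PROVED (`theorem21`; `J₀ = I ⟨h,i,j,k,l⟩` of `PermutationGroupZeta2.lean`, `d_n = Nat.lcmUpto n`, `ζ(2) = zetaValue 2`)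
by the PRINTED descent (pp. 29–31): Lemma 2.1 (`i+j−l ≤ 0`; the Beukers/Hata base, `TheoremTwoOneBase.lean`) with the
normaliser (2.4) (`lemma21`); Lemma 2.2 (`j = k = 0`: `J₀ = J₂` by `τ²`, "`M₂ = N₀`, `N₂ = M₀`") and Lemma 2.3
(`k = l = 0`: `J₀ = J₁` by `τ`) through the tree's `invariance_tau` (g44, `PermutationGroupZeta2Proofs.lean`); then ONE
strong induction on `h+i+j+k+l` (`theorem21_nat`) carrying Lemma 2.4 (`i = k = 0`), Lemma 2.5 (`k = 0`) and the final
step, each by its printed linear decomposition of the integrand —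
  `I(h,0,j,0,l) = I(h,0,j−1,0,l−1) − I(h−1,0,j−1,0,l−1) + I(h−1,0,j−1,0,l)`   [`x(1−y) = (1−xy) − (1−x)`],
  `I(h,i,j,0,l) = I(h,i,j−1,0,l−1) + I(h,i−1,j,0,l−1) − I(h,i−1,j−1,0,l−1)` [`(1−x)(1−y) = (1−x)+(1−y)−(1−xy)`],
  `I(h,i,j,k,l) = I(h−1,i,j,k−1,l) − I(h−1,i,j,k−1,l+1)`                    [`xy = 1 − (1−xy)`] —
with `σ : x ↔ y` (`invariance_sigma`, which leaves `M₀, N₀` invariant: `M₀_sigma`, `N₀_sigma`) for `h = 0`, and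
"`M₀^{(r)}, N₀^{(r)}` do not exceed `M₀, N₀`" as entrywise monotonicity in the five integers (1.9) (`indices_mono`).
At natural parameters the maxima (2.4) are written with truncated subtraction, which does not change their values
(both are `≥ 0`, Remark 2.1: `M₀_nonneg`, `N₀_nonneg`); `theorem21` states them over `ℤ` exactly as printed, through
`Int.toNat`. COROLLARY: Beukers' integral (1.2) `I(n,n,n,n,n) = a_n − b_n ζ(2)`, `b_n ∈ ℤ`, `d_n² a_n ∈ ℤ`
(`beukers_integral_shape`).

Deliberately NOT here (quoted in `PermutationGroupZeta2.lean`, untyped): Theorem 2.2 (the best pair `M, N` of (2.9)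
among the `τ`-rotations), Theorems 4.1–4.2, Theorem 5.1 and §5 (`μ(ζ(2)) < 5.441243`). HONEST FRAMING (cell pub-zeta5:
systematic search; no irrationality claim unless certified): the ARITHMETIC (denominators) of a 1996 family of
`ζ(2)`-integrals as printed; no measure, no record, nothing about `ζ(5)`; records in print unmoved.

## References
* [RhinViola1996] G. Rhin, C. Viola, Acta Arith. 77 (1996) 23–56, Theorem 2.1, Remark 2.1, Lemmas 2.1–2.5 and the
  proof of Theorem 2.1 (pp. 29–31).
-/

noncomputable section

open MeasureTheory Set Filter Topology

namespace Literature.NumberTheory.Irrationality.RhinViola1996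

open Literature.NumberTheory.Transcendental (zetaValue)
open Literature.NumberTheory.LFunctions (lcmUpto_dvd_lcmUpto_of_le)

/-! ### Monotonicity of the normalising product `d_M d_N` in the pair `(M, N)` -/

/-- If `(M′, N′) ≤ (M, N)` entrywise, or entrywise after interchanging `M′, N′`, then the shape with
`d_{M′} d_{N′}` implies the shape with `d_M d_N` ("the integers `M₀^{(r)}, N₀^{(r)}` do not exceed the
corresponding integers `M₀, N₀`"; "`M₂ = N₀`, `N₂ = M₀`"). [cite: RhinViola1996, §2, proofs of Lemmas 2.2–2.4, pp. 29–31] -/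
theorem shape_lcm_mono {M N M' N' : ℕ} {v : ℝ} (hle : M' ≤ M ∧ N' ≤ N ∨ M' ≤ N ∧ N' ≤ M)
    (hv : ∃ (a : ℚ) (b : ℤ), v = a - b * zetaValue 2 ∧ ∃ A : ℤ, ((Nat.lcmUpto M' * Nat.lcmUpto N' : ℕ) : ℚ) * a = A) :
    ∃ (a : ℚ) (b : ℤ), v = a - b * zetaValue 2 ∧ ∃ A : ℤ, ((Nat.lcmUpto M * Nat.lcmUpto N : ℕ) : ℚ) * a = A := by
  rcases hle with ⟨h1, h2⟩ | ⟨h1, h2⟩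
  · exact shape_mono (Nat.mul_dvd_mul (lcmUpto_dvd_lcmUpto_of_le h1) (lcmUpto_dvd_lcmUpto_of_le h2)) hv
  · exact shape_mono ((Nat.mul_dvd_mul (lcmUpto_dvd_lcmUpto_of_le h1) (lcmUpto_dvd_lcmUpto_of_le h2)).trans
      (dvd_of_eq (mul_comm _ _))) hv

/-- Entrywise monotonicity of the pair (2.4) in the five integers (1.9) `(j+k−h, k+l−i, l+h−j, h+i−k, i+j−l)`
("at least one of the integers … is smaller than the corresponding integer …, while none is larger … we see that
`M₀^{(r)}, N₀^{(r)}` do not exceed the corresponding integers `M₀, N₀`"). [cite: RhinViola1996, §2 Lemma 2.4 (proof), p. 30] -/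
theorem indices_mono {a b c d e a' b' c' d' e' : ℕ} (ha : a' ≤ a) (hb : b' ≤ b) (hc : c' ≤ c) (hd : d' ≤ d)
    (he : e' ≤ e) :
    max (max b' c') e' ≤ max (max b c) e ∧ max (max a' (min b' c')) d' ≤ max (max a (min b c)) d :=
  ⟨max_le_max (max_le_max hb hc) he, max_le_max (max_le_max ha (min_le_min hb hc)) hd⟩

/-- `M₀` is invariant under `σ = (h k)(i j)` ("the integers `M₀, N₀` defined by (2.4) are invariant under the action
of `σ`"), at natural parameters. [cite: RhinViola1996, §2 p. 31] -/
theorem M₀_sigma (h i j k l : ℕ) :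
    max (max (h + l - j) (l + k - i)) (j + i - l) = max (max (k + l - i) (l + h - j)) (i + j - l) := by
  rw [Nat.add_comm h l, Nat.add_comm l k, Nat.add_comm j i, max_comm (l + h - j) (k + l - i)]

/-- `N₀` is invariant under `σ = (h k)(i j)`, at natural parameters. [cite: RhinViola1996, §2 p. 31] -/
theorem N₀_sigma (h i j k l : ℕ) :
    max (max (i + h - k) (min (h + l - j) (l + k - i))) (k + j - h) =
      max (max (j + k - h) (min (k + l - i) (l + h - j))) (h + i - k) := by
  rw [Nat.add_comm i h, Nat.add_comm h l, Nat.add_comm l k, Nat.add_comm k j, min_comm (l + h - j) (k + l - i)]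
  generalize h + i - k = A
  generalize j + k - h = B
  generalize min (k + l - i) (l + h - j) = C
  ac_rfl

/-! ### Lemma 2.1 (Beukers [1]): the case `i + j − l ≤ 0`, with the normaliser (2.4)

Throughout, at natural parameters the printed integers (2.4) `M₀ = max{k+l−i, l+h−j, i+j−l}` and
`N₀ = max{j+k−h, min{k+l−i, l+h−j}, h+i−k}` are written with truncated subtraction in `ℕ`; this does not change their
values since both maxima are attained at non-negative entries (Remark 2.1; see `M₀_nonneg`, `N₀_nonneg` below). -/

/-- **Lemma 2.1** ("If `i + j − l ≤ 0`, then Theorem 2.1 holds"), natural parameters.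
[cite: RhinViola1996, §2 Lemma 2.1, p. 29] -/
theorem lemma21 (h i j k l : ℕ) (hle : i + j ≤ l) :
    ∃ (a : ℚ) (b : ℤ), I ⟨h, i, j, k, l⟩ = a - b * zetaValue 2 ∧ ∃ A : ℤ,
      ((Nat.lcmUpto (max (max (k + l - i) (l + h - j)) (i + j - l)) *
        Nat.lcmUpto (max (max (j + k - h) (min (k + l - i) (l + h - j))) (h + i - k)) : ℕ) : ℚ) * a = A := by
  rcases Nat.lt_or_ge (i + j) l with hlt | hge
  · -- `i + j − l < 0`: the polynomial case, `d_{k+l−i} d_{l+h−j}`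
    obtain ⟨e, rfl⟩ : ∃ e, l = i + j + e + 1 := ⟨l - i - j - 1, by omega⟩
    obtain ⟨ρ, hρ, hz⟩ := lemma21_lt h i j k e
    have base : ∃ (a : ℚ) (b : ℤ), I ⟨h, i, j, k, (i + j + e + 1 : ℕ)⟩ = a - b * zetaValue 2 ∧ ∃ A : ℤ,
        ((Nat.lcmUpto (h + i + e + 1) * Nat.lcmUpto (k + j + e + 1) : ℕ) : ℚ) * a = A := shape_of_rat hρ hz
    rcases le_total (h + i + e + 1) (k + j + e + 1) with hc | hc
    · refine shape_lcm_mono ?_ base; exact Or.inr ⟨by omega, by omega⟩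
    · refine shape_lcm_mono ?_ base; exact Or.inl ⟨by omega, by omega⟩
  · -- `i + j − l = 0`: Hata's case
    obtain rfl : l = i + j := le_antisymm hge hle
    refine shape_lcm_mono ?_ (lemma21_eq h i j k); exact Or.inl ⟨by omega, by omega⟩

/-! ### Lemmas 2.2 and 2.3: `τ`-rotations into Lemma 2.1 -/

/-- **Lemma 2.2** ("If `j = k = 0`, then Theorem 2.1 holds": `J₀ = I(h,i,0,0,l) = J₂ = I(0,0,l,h,i)`, `M₂ = N₀`,
`N₂ = M₀`; Lemma 2.1 applies to `J₀` if `i − l ≤ 0`, to `J₂` if `i − l ≥ 0`).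
[cite: RhinViola1996, §2 Lemma 2.2, pp. 29–30] -/
theorem lemma22 (h i l : ℕ) :
    ∃ (a : ℚ) (b : ℤ), I ⟨h, i, (0 : ℕ), (0 : ℕ), l⟩ = a - b * zetaValue 2 ∧ ∃ A : ℤ,
      ((Nat.lcmUpto (max (max (0 + l - i) (l + h - 0)) (i + 0 - l)) *
        Nat.lcmUpto (max (max (0 + 0 - h) (min (0 + l - i) (l + h - 0))) (h + i - 0)) : ℕ) : ℚ) * a = A := by
  rcases Nat.lt_or_ge l i with hlt | hge
  · -- rotate twice: `J₀ = J₂`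
    have hrot : I ⟨h, i, (0 : ℕ), (0 : ℕ), l⟩ = I ⟨(0 : ℕ), (0 : ℕ), l, h, i⟩ := by
      rw [← invariance_tau ⟨h, i, (0 : ℕ), (0 : ℕ), l⟩, ← invariance_tau (tau ⟨h, i, (0 : ℕ), (0 : ℕ), l⟩)]; rfl
    rw [hrot]
    refine shape_lcm_mono ?_ (lemma21 0 0 l h i (by omega)); exact Or.inr ⟨by omega, by omega⟩
  · exact lemma21 h i 0 0 l (by omega)

/-- **Lemma 2.3** ("If `k = l = 0`, then Theorem 2.1 holds": `J₀ = I(h,i,j,0,0) = J₁ = I(i,j,0,0,h)`, `M₁ = N₀`,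
`N₁ = M₀`, and Lemma 2.2 applies to `J₁`). [cite: RhinViola1996, §2 Lemma 2.3, p. 30] -/
theorem lemma23 (h i j : ℕ) :
    ∃ (a : ℚ) (b : ℤ), I ⟨h, i, j, (0 : ℕ), (0 : ℕ)⟩ = a - b * zetaValue 2 ∧ ∃ A : ℤ,
      ((Nat.lcmUpto (max (max (0 + 0 - i) (0 + h - j)) (i + j - 0)) *
        Nat.lcmUpto (max (max (j + 0 - h) (min (0 + 0 - i) (0 + h - j))) (h + i - 0)) : ℕ) : ℚ) * a = A := by
  have hrot : I ⟨h, i, j, (0 : ℕ), (0 : ℕ)⟩ = I ⟨i, j, (0 : ℕ), (0 : ℕ), h⟩ := by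
    rw [← invariance_tau ⟨h, i, j, (0 : ℕ), (0 : ℕ)⟩]; rfl
  rw [hrot]
  refine shape_lcm_mono ?_ (lemma22 i j h); exact Or.inr ⟨by omega, by omega⟩

/-! ### The three linear decompositions of the integrand -/

/-- Linearity of `I` along a pointwise identity of integrands on the square (three integrable pieces with
real coefficients). [folklore] -/
private theorem I_eq_of_integrand_eq {P P₁ P₂ P₃ : Params} (ε₂ ε₃ : ℝ) (h₁ : IntegrableOn (integrand P₁) square)
    (h₂ : IntegrableOn (integrand P₂) square) (h₃ : IntegrableOn (integrand P₃) square)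
    (hpt : ∀ p ∈ square, integrand P p = integrand P₁ p + ε₂ * integrand P₂ p + ε₃ * integrand P₃ p) :
    I P = I P₁ + ε₂ * I P₂ + ε₃ * I P₃ := by
  have i2 : Integrable (fun p => ε₂ * integrand P₂ p) (volume.restrict square) := h₂.const_mul ε₂
  have i3 : Integrable (fun p => ε₃ * integrand P₃ p) (volume.restrict square) := h₃.const_mul ε₃
  have i12 : Integrable (fun p => integrand P₁ p + ε₂ * integrand P₂ p) (volume.restrict square) := h₁.add i2
  unfold I
  rw [setIntegral_congr_fun measurableSet_square hpt, integral_add i12 i3, integral_add h₁ i2,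
    integral_const_mul, integral_const_mul]

/-- The decomposition of Lemma 2.4 (case `i = k = 0`, `min{h, l, j−l} > 0`), pointwise:
from `x(1−y) = (1−xy) − (1−x)`. [cite: RhinViola1996, §2 Lemma 2.4 (proof), p. 30] -/
theorem integrand_decomp24 (h j l : ℕ) {p : Fin 2 → ℝ} (hp : p ∈ square) :
    integrand ⟨(h + 1 : ℕ), (0 : ℕ), (j + 1 : ℕ), (0 : ℕ), (l + 1 : ℕ)⟩ p =
      integrand ⟨(h + 1 : ℕ), (0 : ℕ), j, (0 : ℕ), l⟩ p + (-1) * integrand ⟨h, (0 : ℕ), j, (0 : ℕ), l⟩ p +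
        1 * integrand ⟨h, (0 : ℕ), j, (0 : ℕ), (l + 1 : ℕ)⟩ p := by
  have hW := (one_sub_mul_pos hp).ne'
  rw [integrand_natCast (h + 1) 0 (j + 1) 0 (l + 1) hp, integrand_natCast (h + 1) 0 j 0 l hp,
    integrand_natCast h 0 j 0 l hp, integrand_natCast h 0 j 0 (l + 1) hp]
  simp only [pow_zero, mul_one, zero_add, pow_succ]
  field_simp
  ring

/-- **The decomposition of Lemma 2.4**: `I(h,0,j,0,l) = I(h,0,j−1,0,l−1) − I(h−1,0,j−1,0,l−1) + I(h−1,0,j−1,0,l)`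
(for `h, j, l ≥ 1`, written at successors). [cite: RhinViola1996, §2 Lemma 2.4 (proof), p. 30] -/
theorem I_decomp24 (h j l : ℕ) :
    I ⟨(h + 1 : ℕ), (0 : ℕ), (j + 1 : ℕ), (0 : ℕ), (l + 1 : ℕ)⟩ =
      I ⟨(h + 1 : ℕ), (0 : ℕ), j, (0 : ℕ), l⟩ + (-1) * I ⟨h, (0 : ℕ), j, (0 : ℕ), l⟩ +
        1 * I ⟨h, (0 : ℕ), j, (0 : ℕ), (l + 1 : ℕ)⟩ :=
  I_eq_of_integrand_eq (-1) 1 (integrableOn_integrand_natCast _ _ _ _ _) (integrableOn_integrand_natCast _ _ _ _ _)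
    (integrableOn_integrand_natCast _ _ _ _ _) fun _ hp => integrand_decomp24 h j l hp

/-- The decomposition of Lemma 2.5 (case `k = 0`, `min{i, j, l, i+j−l} > 0`), pointwise:
from `(1−x)(1−y) = (1−x) + (1−y) − (1−xy)`. [cite: RhinViola1996, §2 Lemma 2.5 (proof), p. 31] -/
theorem integrand_decomp25 (h i j l : ℕ) {p : Fin 2 → ℝ} (hp : p ∈ square) :
    integrand ⟨h, (i + 1 : ℕ), (j + 1 : ℕ), (0 : ℕ), (l + 1 : ℕ)⟩ p =
      integrand ⟨h, (i + 1 : ℕ), j, (0 : ℕ), l⟩ p + 1 * integrand ⟨h, i, (j + 1 : ℕ), (0 : ℕ), l⟩ p +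
        (-1) * integrand ⟨h, i, j, (0 : ℕ), l⟩ p := by
  have hW := (one_sub_mul_pos hp).ne'
  rw [integrand_natCast h (i + 1) (j + 1) 0 (l + 1) hp, integrand_natCast h (i + 1) j 0 l hp,
    integrand_natCast h i (j + 1) 0 l hp, integrand_natCast h i j 0 l hp]
  simp only [pow_zero, mul_one, pow_succ]
  field_simp
  ring

/-- **The decomposition of Lemma 2.5**: `I(h,i,j,0,l) = I(h,i,j−1,0,l−1) + I(h,i−1,j,0,l−1) − I(h,i−1,j−1,0,l−1)`
(for `i, j, l ≥ 1`, written at successors). [cite: RhinViola1996, §2 Lemma 2.5 (proof), p. 31] -/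
theorem I_decomp25 (h i j l : ℕ) :
    I ⟨h, (i + 1 : ℕ), (j + 1 : ℕ), (0 : ℕ), (l + 1 : ℕ)⟩ =
      I ⟨h, (i + 1 : ℕ), j, (0 : ℕ), l⟩ + 1 * I ⟨h, i, (j + 1 : ℕ), (0 : ℕ), l⟩ + (-1) * I ⟨h, i, j, (0 : ℕ), l⟩ :=
  I_eq_of_integrand_eq 1 (-1) (integrableOn_integrand_natCast _ _ _ _ _) (integrableOn_integrand_natCast _ _ _ _ _)
    (integrableOn_integrand_natCast _ _ _ _ _) fun _ hp => integrand_decomp25 h i j l hp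

/-- The decomposition in the proof of Theorem 2.1 (case `min{h, k, i+j−l} > 0`), pointwise:
from `xy = 1 − (1−xy)`. [cite: RhinViola1996, §2, proof of Theorem 2.1, p. 31] -/
theorem integrand_decompThm (h i j k l : ℕ) {p : Fin 2 → ℝ} (hp : p ∈ square) :
    integrand ⟨(h + 1 : ℕ), i, j, (k + 1 : ℕ), l⟩ p =
      integrand ⟨h, i, j, k, l⟩ p + (-1) * integrand ⟨h, i, j, k, (l + 1 : ℕ)⟩ p + 0 * integrand ⟨h, i, j, k, l⟩ p := by
  have hW := (one_sub_mul_pos hp).ne'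
  rw [integrand_natCast (h + 1) i j (k + 1) l hp, integrand_natCast h i j k l hp,
    integrand_natCast h i j k (l + 1) hp]
  simp only [pow_succ]
  field_simp
  ring

/-- **The decomposition of the proof of Theorem 2.1**: `I(h,i,j,k,l) = I(h−1,i,j,k−1,l) − I(h−1,i,j,k−1,l+1)`
(for `h, k ≥ 1`, written at successors). [cite: RhinViola1996, §2, proof of Theorem 2.1, p. 31] -/
theorem I_decompThm (h i j k l : ℕ) :
    I ⟨(h + 1 : ℕ), i, j, (k + 1 : ℕ), l⟩ = I ⟨h, i, j, k, l⟩ + (-1) * I ⟨h, i, j, k, (l + 1 : ℕ)⟩ + 0 * I ⟨h, i, j, k, l⟩ :=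
  I_eq_of_integrand_eq (-1) 0 (integrableOn_integrand_natCast _ _ _ _ _) (integrableOn_integrand_natCast _ _ _ _ _)
    (integrableOn_integrand_natCast _ _ _ _ _) fun _ hp => integrand_decompThm h i j k l hp

/-! ### The descent (Lemmas 2.4, 2.5 and the proof of Theorem 2.1): strong induction on `h+i+j+k+l` -/

/-- The step of the descent at `k = 0` (Lemmas 2.4 and 2.5): Theorem 2.1 for `(h,i,j,0,l)`, given Theorem 2.1 for
all parameter sets with smaller `h+i+j+k+l`. [cite: RhinViola1996, §2 Lemmas 2.4–2.5, pp. 30–31] -/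
theorem step_k_zero (n : ℕ)
    (IH : ∀ m < n, ∀ h i j k l : ℕ, h + i + j + k + l = m →
      ∃ (a : ℚ) (b : ℤ), I ⟨h, i, j, k, l⟩ = a - b * zetaValue 2 ∧ ∃ A : ℤ,
        ((Nat.lcmUpto (max (max (k + l - i) (l + h - j)) (i + j - l)) *
          Nat.lcmUpto (max (max (j + k - h) (min (k + l - i) (l + h - j))) (h + i - k)) : ℕ) : ℚ) * a = A)
    (h i j l : ℕ) (hn : h + i + j + 0 + l = n) :
    ∃ (a : ℚ) (b : ℤ), I ⟨h, i, j, (0 : ℕ), l⟩ = a - b * zetaValue 2 ∧ ∃ A : ℤ,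
      ((Nat.lcmUpto (max (max (0 + l - i) (l + h - j)) (i + j - l)) *
        Nat.lcmUpto (max (max (j + 0 - h) (min (0 + l - i) (l + h - j))) (h + i - 0)) : ℕ) : ℚ) * a = A := by
  by_cases hA : i + j ≤ l
  · exact lemma21 h i j 0 l hA
  rcases Nat.eq_zero_or_pos i with hi | hi
  · -- Lemma 2.4: `i = k = 0`
    subst hi
    rcases Nat.eq_zero_or_pos h with hh | hh
    · -- `h = 0`: interchange `x, y` and apply Lemma 2.2
      subst hh
      have hσ : I ⟨(0 : ℕ), (0 : ℕ), j, (0 : ℕ), l⟩ = I ⟨(0 : ℕ), j, (0 : ℕ), (0 : ℕ), l⟩ := by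
        rw [← invariance_sigma ⟨(0 : ℕ), (0 : ℕ), j, (0 : ℕ), l⟩]; rfl
      rw [hσ]
      exact shape_lcm_mono (Or.inl ⟨(M₀_sigma 0 0 j 0 l).le, (N₀_sigma 0 0 j 0 l).le⟩) (lemma22 0 j l)
    rcases Nat.eq_zero_or_pos l with hl | hl
    · -- `l = 0`: Lemma 2.3
      subst hl
      exact lemma23 h 0 j
    -- `min{h, l, j − l} > 0`: the decomposition of Lemma 2.4
    obtain ⟨h', rfl⟩ : ∃ h', h = h' + 1 := ⟨h - 1, by omega⟩
    obtain ⟨l', rfl⟩ : ∃ l', l = l' + 1 := ⟨l - 1, by omega⟩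
    obtain ⟨j', rfl⟩ : ∃ j', j = j' + 1 := ⟨j - 1, by omega⟩
    rw [I_decomp24 h' j' l']
    refine shape_add (shape_add ?_ (shape_neg_one_mul ?_)) (shape_one_mul ?_)
    · refine shape_lcm_mono (Or.inl (indices_mono ?_ ?_ ?_ ?_ ?_)) (IH _ (by omega) (h' + 1) 0 j' 0 l' rfl) <;> omega
    · refine shape_lcm_mono (Or.inl (indices_mono ?_ ?_ ?_ ?_ ?_)) (IH _ (by omega) h' 0 j' 0 l' rfl) <;> omega
    · refine shape_lcm_mono (Or.inl (indices_mono ?_ ?_ ?_ ?_ ?_)) (IH _ (by omega) h' 0 j' 0 (l' + 1) rfl) <;> omega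
  rcases Nat.eq_zero_or_pos j with hj | hj
  · subst hj; exact lemma22 h i l
  rcases Nat.eq_zero_or_pos l with hl | hl
  · subst hl; exact lemma23 h i j
  -- Lemma 2.5: `min{i, j, l, i+j−l} > 0`
  obtain ⟨i', rfl⟩ : ∃ i', i = i' + 1 := ⟨i - 1, by omega⟩
  obtain ⟨j', rfl⟩ : ∃ j', j = j' + 1 := ⟨j - 1, by omega⟩
  obtain ⟨l', rfl⟩ : ∃ l', l = l' + 1 := ⟨l - 1, by omega⟩
  rw [I_decomp25 h i' j' l']
  refine shape_add (shape_add ?_ (shape_one_mul ?_)) (shape_neg_one_mul ?_)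
  · refine shape_lcm_mono (Or.inl (indices_mono ?_ ?_ ?_ ?_ ?_)) (IH _ (by omega) h (i' + 1) j' 0 l' rfl) <;> omega
  · refine shape_lcm_mono (Or.inl (indices_mono ?_ ?_ ?_ ?_ ?_)) (IH _ (by omega) h i' (j' + 1) 0 l' rfl) <;> omega
  · refine shape_lcm_mono (Or.inl (indices_mono ?_ ?_ ?_ ?_ ?_)) (IH _ (by omega) h i' j' 0 l' rfl) <;> omega

/-- **Theorem 2.1 at natural parameters** (the printed proof: "If `h = 0` or `k = 0` we apply Lemma 2.5, possibly
after interchanging `x` and `y`. If `i + j − l ≤ 0` we apply Lemma 2.1. Hence we may assume `min{h, k, i+j−l} > 0`.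
Then we iterate the decomposition … `= I(h−1,i,j,k−1,l) − I(h−1,i,j,k−1,l+1)`"), by strong induction on
`h+i+j+k+l`. [cite: RhinViola1996, Theorem 2.1 and its proof, pp. 29–31] -/
theorem theorem21_nat (h i j k l : ℕ) :
    ∃ (a : ℚ) (b : ℤ), I ⟨h, i, j, k, l⟩ = a - b * zetaValue 2 ∧ ∃ A : ℤ,
      ((Nat.lcmUpto (max (max (k + l - i) (l + h - j)) (i + j - l)) *
        Nat.lcmUpto (max (max (j + k - h) (min (k + l - i) (l + h - j))) (h + i - k)) : ℕ) : ℚ) * a = A := by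
  suffices H : ∀ n : ℕ, ∀ h i j k l : ℕ, h + i + j + k + l = n →
      ∃ (a : ℚ) (b : ℤ), I ⟨h, i, j, k, l⟩ = a - b * zetaValue 2 ∧ ∃ A : ℤ,
        ((Nat.lcmUpto (max (max (k + l - i) (l + h - j)) (i + j - l)) *
          Nat.lcmUpto (max (max (j + k - h) (min (k + l - i) (l + h - j))) (h + i - k)) : ℕ) : ℚ) * a = A from
    H _ h i j k l rfl
  intro n
  induction n using Nat.strong_induction_on with
  | _ n IH =>
    intro h i j k l hn
    by_cases hA : i + j ≤ l
    · exact lemma21 h i j k l hA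
    rcases Nat.eq_zero_or_pos k with hk | hk
    · subst hk; exact step_k_zero n IH h i j l hn
    rcases Nat.eq_zero_or_pos h with hh | hh
    · -- `h = 0`: interchange `x, y` (`σ`), which leaves `M₀, N₀` invariant, and apply the case `k = 0`
      subst hh
      have hσ : I ⟨(0 : ℕ), i, j, k, l⟩ = I ⟨k, j, i, (0 : ℕ), l⟩ := by
        rw [← invariance_sigma ⟨(0 : ℕ), i, j, k, l⟩]; rfl
      rw [hσ]
      exact shape_lcm_mono (Or.inl ⟨(M₀_sigma 0 i j k l).le, (N₀_sigma 0 i j k l).le⟩)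
        (step_k_zero n IH k j i l (by omega))
    -- `min{h, k, i+j−l} > 0`: the decomposition of the proof of Theorem 2.1
    obtain ⟨h', rfl⟩ : ∃ h', h = h' + 1 := ⟨h - 1, by omega⟩
    obtain ⟨k', rfl⟩ : ∃ k', k = k' + 1 := ⟨k - 1, by omega⟩
    rw [I_decompThm h' i j k' l]
    refine shape_add (shape_add ?_ (shape_neg_one_mul ?_)) (shape_zero_mul _)
    · refine shape_lcm_mono (Or.inl (indices_mono ?_ ?_ ?_ ?_ ?_)) (IH _ (by omega) h' i j k' l rfl) <;> omega
    · refine shape_lcm_mono (Or.inl (indices_mono ?_ ?_ ?_ ?_ ?_)) (IH _ (by omega) h' i j k' (l + 1) rfl) <;> omega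

/-! ### Theorem 2.1 as printed: integer parameters `h, i, j, k, l ≥ 0` -/

/-- Remark 2.1, first half: for `h, i, j, k, l ≥ 0` the integer `M₀` of (2.4) is `≥ 0`.
[cite: RhinViola1996, §2 Remark 2.1, p. 29] -/
theorem M₀_nonneg {P : Params} (hP : P.Nonneg) :
    0 ≤ max (max (P.k + P.l - P.i) (P.l + P.h - P.j)) (P.i + P.j - P.l) := by
  obtain ⟨_, _, _, _, _⟩ := hP
  omega

/-- Remark 2.1, second half: for `h, i, j, k, l ≥ 0` the integer `N₀` of (2.4) is `≥ 0`.
[cite: RhinViola1996, §2 Remark 2.1, p. 29] -/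
theorem N₀_nonneg {P : Params} (hP : P.Nonneg) :
    0 ≤ max (max (P.j + P.k - P.h) (min (P.k + P.l - P.i) (P.l + P.h - P.j))) (P.h + P.i - P.k) := by
  obtain ⟨_, _, _, _, _⟩ := hP
  omega

/-- **Rhin–Viola 1996, Theorem 2.1.** Let `h, i, j, k, l` be non-negative integers, and let (2.4)
`M₀ = max{k+l−i, l+h−j, i+j−l}`, `N₀ = max{j+k−h, min{k+l−i, l+h−j}, h+i−k}`. Then the integral
`J₀ = I(h,i,j,k,l) = ∫₀¹∫₀¹ x^h(1−x)^i y^k(1−y)^j/(1−xy)^{i+j−l} · dx dy/(1−xy)` satisfies `J₀ = a − bζ(2)` with `b ∈ ℤ`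
and `d_{M₀} d_{N₀} a ∈ ℤ` (`d_n = lcm{1,…,n}` = `Nat.lcmUpto n`, `d_0 = 1`; `ζ(2) = zetaValue 2`; the two maxima, which
are `≥ 0` by `M₀_nonneg` / `N₀_nonneg`, enter through `Int.toNat`). PROVED by the printed descent (`theorem21_nat`).
[cite: RhinViola1996, Theorem 2.1, p. 29] -/
theorem theorem21 {P : Params} (hP : P.Nonneg) :
    ∃ (a : ℚ) (b : ℤ), I P = a - b * zetaValue 2 ∧ ∃ A : ℤ,
      ((Nat.lcmUpto (max (max (P.k + P.l - P.i) (P.l + P.h - P.j)) (P.i + P.j - P.l)).toNat *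
        Nat.lcmUpto (max (max (P.j + P.k - P.h) (min (P.k + P.l - P.i) (P.l + P.h - P.j))) (P.h + P.i - P.k)).toNat
          : ℕ) : ℚ) * a = A := by
  obtain ⟨h, i, j, k, l⟩ := P
  obtain ⟨hh, hi, hj, hk, hl⟩ := hP
  simp only at hh hi hj hk hl ⊢
  lift h to ℕ using hh
  lift i to ℕ using hi
  lift j to ℕ using hj
  lift k to ℕ using hk
  lift l to ℕ using hl
  have e1 : (max (max ((k : ℤ) + l - i) (l + h - j)) (i + j - l)).toNat = max (max (k + l - i) (l + h - j)) (i + j - l) := by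
    omega
  have e2 : (max (max ((j : ℤ) + k - h) (min ((k : ℤ) + l - i) (l + h - j))) (h + i - k)).toNat =
      max (max (j + k - h) (min (k + l - i) (l + h - j))) (h + i - k) := by
    omega
  rw [e1, e2]
  exact theorem21_nat h i j k l

/-! ### Beukers' integral (1.2) -/

/-- The integrand of `I(n,n,n,n,n)` is Beukers' `(x(1−x)y(1−y)/(1−xy))^n · 1/(1−xy)` of (1.2) on the open square.
[cite: RhinViola1996, §1 (1.2), p. 24] -/
theorem integrand_beukers (n : ℕ) {p : Fin 2 → ℝ} (hp : p ∈ square) :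
    integrand ⟨n, n, n, n, n⟩ p = (p 0 * (1 - p 0) * p 1 * (1 - p 1) / (1 - p 0 * p 1)) ^ n / (1 - p 0 * p 1) := by
  have hW := (one_sub_mul_pos hp).ne'
  rw [integrand_natCast n n n n n hp, div_pow, mul_pow, mul_pow, mul_pow]
  field_simp
  ring

/-- **Beukers' integral has the shape `a_n − b_n ζ(2)` with `b_n ∈ ℤ` and `d_n² a_n ∈ ℤ`**: Theorem 2.1 at
`h = i = j = k = l = n`, where (2.4) gives `M₀ = N₀ = n` ("the left side of (1.2) is easily seen to be `a_n − b_n ζ(2)`, with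
`b_n` integer and `a_n` a rational number having a controlled denominator"). [cite: RhinViola1996, §1 (1.2), p. 24] -/
theorem beukers_integral_shape (n : ℕ) :
    ∃ (a : ℚ) (b : ℤ), I ⟨n, n, n, n, n⟩ = a - b * zetaValue 2 ∧
      ∃ A : ℤ, ((Nat.lcmUpto n * Nat.lcmUpto n : ℕ) : ℚ) * a = A := by
  have h := theorem21_nat n n n n n
  have e1 : max (max (n + n - n) (n + n - n)) (n + n - n) = n := by omega
  have e2 : max (max (n + n - n) (min (n + n - n) (n + n - n))) (n + n - n) = n := by omega
  rw [e1, e2] at h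
  exact h

end Literature.NumberTheory.Irrationality.RhinViola1996

end
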